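import Mathlib
import Summits.Ventures.PercRepro2.TypedBHKIndepFlip

/-!
# Typed BHK 1.4 single-vertex on the INDEPENDENT CLASS — II: sources, `b ∈ S` and `o ∈ T′` after `Φ`
(p5 g3, 2026-08-25; file 2 of 4). Facts about a source (`IsSource`: `Q` in both copies, `b ∈ C₁(y)`,
`o ∈ C₂(y)`, `o ∉ C₂(flipOn F y)`), and the cluster lemmas: `conn_Φ_a1_b` (item 4 of P5-SHAPE.md
§10) and `conn_flipOn_Φ_a2_o` (item 6), both by contradiction + the closure lemma.
-/

namespace Summit.Ventures.PercRepro2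

namespace TypedBHKIndep

open CovForm A3InactiveTyped TB14Fold

section Clusters

variable {V : Type} {E : Type} [Fintype E] [DecidableEq E] [DecidableEq V]
variable (ends : E → Sym2 V) (a₁ a₂ b o : V) (F : Finset E)

section SourceFacts

variable {y : Config E} (hs : IsSource ends a₁ a₂ b o F y)
include hs

omit [Fintype E] [DecidableEq V] in
/-- In a source, `a₁` is not in the first-copy cluster of `a₂`. -/
lemma src_ne_a1 {v : V} (hv : Conn ends y a₂ v) : v ≠ a₁ := by
  rintro rfl; exact hs.q₁ (conn_symm hv)

omit [Fintype E] [DecidableEq V] in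
/-- In a source, `b` is not in the first-copy cluster of `a₂`. -/
lemma src_ne_b {v : V} (hv : Conn ends y a₂ v) : v ≠ b := by
  rintro rfl; exact hs.q₁ (conn_trans hs.hb (conn_symm hv))

omit [Fintype E] [DecidableEq V] in
/-- In a source, `o ≠ a₂`. -/
lemma src_o_ne_a2 : o ≠ a₂ := by
  rintro rfl; exact hs.ho' (conn_refl _ _ _)

omit [Fintype E] [DecidableEq V] in
/-- In a source, a marked vertex of the first-copy cluster of `a₂` is `a₂` or `o`. -/
lemma src_mark_mem_T {v : V} (hv : Conn ends y a₂ v) (hm : v ∈ marks a₁ a₂ b o) :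
    v = a₂ ∨ v = o := by
  rcases mem_marks.1 hm with h | h | h | h
  · exact absurd h (src_ne_a1 ends a₁ a₂ b o F hs hv)
  · exact Or.inl h
  · exact absurd h (src_ne_b ends a₁ a₂ b o F hs hv)
  · exact Or.inr h

omit [Fintype E] [DecidableEq V] in
/-- In a source, an unmarked vertex `u` with `y`-open edges to both `a₂` and `o` satisfies
`sharesColourAtO`. -/
lemma src_shares_of_two {u : V} (hu : u ∉ marks a₁ a₂ b o)
    {e e₀ : E} (he : y e = true) (hends : ends e = s(u, a₂)) (he₀ : y e₀ = true)
    (hends₀ : ends e₀ = s(u, o)) : sharesColourAtO ends o y u := by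
  refine ⟨e₀, by rw [hends₀]; simp, by rw [hends₀]; simp, e, by rw [hends]; simp, ?_, by rw [he, he₀]⟩
  rintro rfl
  rw [hends] at hends₀
  have : a₂ ∈ s(u, o) := by rw [← hends₀]; simp
  rcases Sym2.mem_iff.1 this with h | h
  · exact hu (by rw [← h]; exact mem_marks.2 (Or.inr (Or.inl rfl)))
  · exact src_o_ne_a2 ends a₁ a₂ b o F hs h.symm

end SourceFacts

omit [Fintype E] [DecidableEq V] in
/-- In a source, a marked vertex of the first-copy cluster of `a₁` is `a₁` or `b`. -/
lemma src_mark_mem_S {y : Config E} (hs : IsSource ends a₁ a₂ b o F y) {v : V}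
    (hv : Conn ends y a₁ v) (hm : v ∈ marks a₁ a₂ b o) : v = a₁ ∨ v = b := by
  rcases mem_marks.1 hm with h | h | h | h
  · exact Or.inl h
  · subst h; exact absurd hv hs.q₁
  · exact Or.inr h
  · subst h; exact absurd (conn_trans hv (conn_symm hs.ho)) hs.q₁

omit [Fintype E] [DecidableEq V] in
/-- In a source, an unmarked vertex with `y`-open edges to `a₁` and to `b` is NOT flipped: its
edge to `o` (if any) is closed and is its only closed edge (a closed edge to `a₂` would join `o`
to `a₂` in the second copy; an open edge to `o` would join the roots). -/
lemma src_not_shares_of_a1_b (hF : ∀ e, e ∈ F) (hcls : IndepClass ends a₁ a₂ b o) {y : Config E}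
    (hs : IsSource ends a₁ a₂ b o F y) {x : V} (hxm : x ∉ marks a₁ a₂ b o) {e e' : E}
    (hye : y e = true) (hends : ends e = s(x, b)) (hye' : y e' = true) (hends' : ends e' = s(x, a₁)) :
    ¬ sharesColourAtO ends o y x := by
  rintro ⟨e₀, hxe₀, hoe₀, e₁, hxe₁, hne, hcol⟩
  obtain ⟨hmk₀, hl₀, hsg₀⟩ := hcls e₀ x hxe₀ hxm
  obtain ⟨hmk₁, hl₁, hsg₁⟩ := hcls e₁ x hxe₁ hxm
  -- the ends of e₀ are {x, o}
  have hends₀ : ends e₀ = s(x, o) := by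
    obtain ⟨w, hw⟩ := Sym2.mem_iff_exists.1 hxe₀
    rw [hw] at hoe₀ ⊢
    rcases Sym2.mem_iff.1 hoe₀ with h | h
    · exact absurd h.symm (fun hxo => hxm (hxo ▸ mem_marks.2 (Or.inr (Or.inr (Or.inr rfl)))))
    · rw [h]
  obtain ⟨w₁, hw₁⟩ := Sym2.mem_iff_exists.1 hxe₁
  have hw₁x : w₁ ≠ x := by rintro rfl; exact hl₁ hw₁
  have hw₁m : w₁ ∈ marks a₁ a₂ b o := hmk₁ w₁ (by rw [hw₁]; simp) hw₁x
  have hw₁o : w₁ ≠ o := by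
    rintro rfl; exact hne (hsg₀ e₁ (by rw [hw₁, hends₀]))
  by_cases hc : y e₀ = true
  · -- o ∈ S ∩ T
    have hoS : Conn ends y a₁ o :=
      conn_trans (conn_of_openAdj ⟨e', hye', by rw [hends', Sym2.eq_swap]⟩) (conn_of_openAdj ⟨e₀, hc, hends₀⟩)
    exact hs.q₁ (conn_trans hoS (conn_symm hs.ho))
  · have hc₀ : y e₀ = false := by simpa using hc
    have hc₁ : y e₁ = false := by rw [hcol, hc₀]
    rcases mem_marks.1 hw₁m with h | h | h | h
    · -- w₁ = a₁: e₁ and e' have the same ends, so e₁ = e' is open — contradiction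
      subst h
      have := hsg₁ e' (by rw [hends', hw₁])
      subst this; rw [hye'] at hc₁; exact Bool.noConfusion hc₁
    · -- w₁ = a₂: o and a₂ are joined in the second copy through x
      subst h
      have h₀ : flipOn F y e₀ = true := by unfold flipOn; rw [if_pos (hF e₀), hc₀]; rfl
      have h₁ : flipOn F y e₁ = true := by unfold flipOn; rw [if_pos (hF e₁), hc₁]; rfl
      exact hs.ho' (conn_trans (conn_of_openAdj ⟨e₁, h₁, by rw [hw₁, Sym2.eq_swap]⟩)
        (conn_of_openAdj ⟨e₀, h₀, hends₀⟩))
    · -- w₁ = b: e₁ = e is open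
      subst h
      have := hsg₁ e (by rw [hends, hw₁])
      subst this; rw [hye] at hc₁; exact Bool.noConfusion hc₁
    · exact hw₁o h

omit [Fintype E] [DecidableEq V] in
/-- A flipped unmarked vertex with a `y`-open edge to `a₂` or to `o` lies in `T`, so all its
`y`-open edges go to `a₂` or `o`. -/
lemma src_open_edges_of_mem_T (hcls : IndepClass ends a₁ a₂ b o) {y : Config E}
    (hs : IsSource ends a₁ a₂ b o F y) {u : V} (hu : u ∉ marks a₁ a₂ b o) (huT : Conn ends y a₂ u)
    {f : E} (hyf : y f = true) (huf : u ∈ ends f) : a₂ ∈ ends f ∨ o ∈ ends f := by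
  obtain ⟨v, hv⟩ := Sym2.mem_iff_exists.1 huf
  have hvu : v ≠ u := by intro h; rw [h] at hv; exact (hcls f u huf hu).2.1 hv
  have hvm : v ∈ marks a₁ a₂ b o := (hcls f u huf hu).1 v (by rw [hv]; simp) hvu
  have hvT : Conn ends y a₂ v := conn_trans huT (conn_of_openAdj ⟨f, hyf, hv⟩)
  rcases src_mark_mem_T ends a₁ a₂ b o F hs hvT hvm with h | h
  · left; rw [hv, h]; simp
  · right; rw [hv, h]; simp

/-- (P5-SHAPE.md §10, item 4) `b` stays joined to `a₁` in the first copy after `Φ`. Proof by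
contradiction: otherwise the `y`-open cluster of `a₁` could not reach `b` (every open route to
`b` ends in an unflipped edge). -/
lemma conn_Φ_a1_b (hF : ∀ e, e ∈ F) (hcls : IndepClass ends a₁ a₂ b o) {y : Config E}
    (hs : IsSource ends a₁ a₂ b o F y) : Conn ends (Φ ends a₁ a₂ b o F y) a₁ b := by
  by_cases hab : a₁ = b
  · subst hab; exact conn_refl _ _ _
  by_contra hno
  have hb2 : b ≠ a₂ := by rintro rfl; exact hs.q₁ hs.hb
  have hbo : b ≠ o := by rintro rfl; exact hs.q₁ (conn_trans hs.hb (conn_symm hs.ho))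
  let Z₀ : Set V := {v | Conn ends y a₁ v ∧ v ≠ b ∧
    ¬ (v ∉ marks a₁ a₂ b o ∧ ∀ e, y e = true → v ∈ ends e → b ∈ ends e ∨ ends e = s(v, v))}
  have ha₁ : a₁ ∈ Z₀ := by
    refine ⟨conn_refl _ _ _, hab, ?_⟩
    rintro ⟨h, -⟩; exact h (mem_marks.2 (Or.inl rfl))
  have hclosed : ∀ x ∈ Z₀, ∀ w, (openGraph ends y).Adj x w → w ∈ Z₀ := by
    rintro x ⟨hxS, hxb, hxp⟩ w hadj
    rw [openGraph_adj] at hadj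
    obtain ⟨hxw, e, hye, hends⟩ := hadj
    have hxe : x ∈ ends e := by rw [hends]; simp
    have hwe : w ∈ ends e := by rw [hends]; simp
    have hwS : Conn ends y a₁ w := conn_trans hxS (conn_of_openAdj ⟨e, hye, hends⟩)
    -- (i) w ≠ b
    have hwb : w ≠ b := by
      intro hwb
      subst w
      by_cases hxm : x ∈ marks a₁ a₂ b o
      · rcases src_mark_mem_S ends a₁ a₂ b o F hs hxS hxm with hx | hx
        · -- e = a₁–b: a mark–mark edge not at o, unflipped, open in Φ y
          subst x
          apply hno
          refine conn_of_openAdj ⟨e, ?_, hends⟩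
          rw [Φ_of_not ends a₁ a₂ b o F]
          · exact hye
          · rintro ⟨-, h | ⟨u, hue, hum, -⟩⟩
            · have hoe := h.1; rw [hends] at hoe
              rcases Sym2.mem_iff.1 hoe with h' | h'
              · have hh := hs.ho; rw [h'] at hh; exact hs.q₁ (conn_symm hh)
              · exact hbo h'.symm
            · rw [hends] at hue
              rcases Sym2.mem_iff.1 hue with h' | h'
              · exact hum (h' ▸ mem_marks.2 (Or.inl rfl))
              · exact hum (h' ▸ mem_marks.2 (Or.inr (Or.inr (Or.inl rfl))))
        · exact hxb hx
      · -- x unmarked, not a red pendant at b: an open non-loop edge e' at x avoids b, so goes to a₁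
        obtain ⟨e', hye', hxe', hbe', hloop⟩ : ∃ e', y e' = true ∧ x ∈ ends e' ∧ b ∉ ends e' ∧ ends e' ≠ s(x, x) := by
          by_contra hcon
          apply hxp
          refine ⟨hxm, fun e' hye' hxe' => ?_⟩
          by_contra hnot
          rw [not_or] at hnot
          exact hcon ⟨e', hye', hxe', hnot.1, hnot.2⟩
        obtain ⟨w', hw'⟩ := Sym2.mem_iff_exists.1 hxe'
        have hw'x : w' ≠ x := by rintro rfl; exact hloop hw'
        have hw'm : w' ∈ marks a₁ a₂ b o := (hcls e' x hxe' hxm).1 w' (by rw [hw']; simp) hw'x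
        have hw'S : Conn ends y a₁ w' := conn_trans hxS (conn_of_openAdj ⟨e', hye', hw'⟩)
        rcases src_mark_mem_S ends a₁ a₂ b o F hs hw'S hw'm with hw'' | hw''
        · subst w'
          -- x has open edges to a₁ (e') and b (e): x is not flipped; both edges are open in Φ y
          have hns := src_not_shares_of_a1_b ends a₁ a₂ b o F hF hcls hs hxm hye hends hye' hw'
          have hunf : ∀ f, x ∈ ends f → f ∉ flipSet ends a₁ a₂ b o y := by
            intro f hxf
            rintro (h | ⟨u, huf, hum, hsh⟩)
            · -- a mark–mark edge cannot contain the unmarked x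
              exact hxm (h.2 x hxf)
            · by_cases hux : u = x
              · subst hux; exact hns hsh
              · exact hum ((hcls f x hxf hxm).1 u huf hux)
          apply hno
          exact conn_trans
            (conn_of_openAdj ⟨e', by rw [Φ_of_not ends a₁ a₂ b o F (fun h => hunf e' hxe' h.2)]; exact hye',
              by rw [hw', Sym2.eq_swap]⟩)
            (conn_of_openAdj ⟨e, by rw [Φ_of_not ends a₁ a₂ b o F (fun h => hunf e hxe h.2)]; exact hye, hends⟩)
        · exact hbe' (by rw [hw', hw'']; simp)
    refine ⟨hwS, hwb, ?_⟩
    -- (ii) w is not a red pendant at b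
    rintro ⟨-, hall⟩
    rcases hall e hye hwe with h | h
    · rw [hends] at h
      rcases Sym2.mem_iff.1 h with h | h
      · exact hxb h.symm
      · exact hwb h.symm
    · rw [hends] at h
      have : x ∈ s(w, w) := by rw [← h]; simp
      exact hxw (Sym2.mem_iff.1 this |>.elim id id)
  have hbZ : b ∈ Z₀ := mem_of_conn_of_closed hclosed ha₁ hs.hb
  exact hbZ.2.1 rfl

/-- (item 6) `o` joins `a₂` in the second copy after `Φ`. Proof by contradiction: if not, the only
`y`-open neighbours of `o` are unmarked vertices all of whose open non-loop edges contain `o`, so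
the `y`-open cluster of `a₂` cannot reach `o`. -/
lemma conn_flipOn_Φ_a2_o (hF : ∀ e, e ∈ F) (hcls : IndepClass ends a₁ a₂ b o) {y : Config E}
    (hs : IsSource ends a₁ a₂ b o F y) : Conn ends (flipOn F (Φ ends a₁ a₂ b o F y)) a₂ o := by
  by_contra hno
  -- «red pendant at o»: unmarked, every open non-loop edge at it contains o
  let Z₀ : Set V := {v | v ≠ o ∧
    ¬ (v ∉ marks a₁ a₂ b o ∧ ∀ e, y e = true → v ∈ ends e → o ∈ ends e ∨ ends e = s(v, v))}
  have ha₂ : a₂ ∈ Z₀ := by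
    refine ⟨(src_o_ne_a2 ends a₁ a₂ b o F hs).symm, ?_⟩
    rintro ⟨h, -⟩; exact h (mem_marks.2 (Or.inr (Or.inl rfl)))
  have hclosed : ∀ x ∈ Z₀, ∀ w, (openGraph ends y).Adj x w → w ∈ Z₀ := by
    rintro x ⟨hxo, hxp⟩ w hadj
    rw [openGraph_adj] at hadj
    obtain ⟨hxw, e, hye, hends⟩ := hadj
    have hxe : x ∈ ends e := by rw [hends]; simp
    have hwe : w ∈ ends e := by rw [hends]; simp
    have hxT : Conn ends y a₂ x → Conn ends y a₂ w :=
      fun h => conn_trans h (conn_of_openAdj ⟨e, hye, hends⟩)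
    -- (i) w ≠ o
    have hwo : w ≠ o := by
      intro hwo
      subst hwo
      have hxT' : Conn ends y a₂ x :=
        conn_trans hs.ho (conn_of_openAdj ⟨e, hye, by rw [hends, Sym2.eq_swap]⟩)
      by_cases hxm : x ∈ marks a₁ a₂ b w
      · rcases src_mark_mem_T ends a₁ a₂ b w F hs hxT' hxm with hx | hx
        · -- e = a₂–o is a mark–mark edge at o: flipped, open in the second copy
          subst x
          apply hno
          refine conn_of_openAdj ⟨e, open2_of_flipped ends a₁ a₂ b w F hF (Or.inl ⟨hwe, ?_⟩) hye, hends⟩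
          intro v hv
          rw [hends] at hv
          rcases Sym2.mem_iff.1 hv with rfl | rfl
          · exact mem_marks.2 (Or.inr (Or.inl rfl))
          · exact mem_marks.2 (Or.inr (Or.inr (Or.inr rfl)))
        · exact hxo hx
      · -- x unmarked and not a red pendant at o: an open non-loop edge e' at x avoids o
        obtain ⟨e', hye', hxe', hoe', hloop⟩ : ∃ e', y e' = true ∧ x ∈ ends e' ∧ w ∉ ends e' ∧ ends e' ≠ s(x, x) := by
          by_contra hcon
          apply hxp
          refine ⟨hxm, fun e' hye' hxe' => ?_⟩
          by_contra hnot
          rw [not_or] at hnot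
          exact hcon ⟨e', hye', hxe', hnot.1, hnot.2⟩
        obtain ⟨w', hw'⟩ := Sym2.mem_iff_exists.1 hxe'
        have hw'x : w' ≠ x := by
          rintro rfl; exact hloop hw'
        have hw'm : w' ∈ marks a₁ a₂ b w := (hcls e' x hxe' hxm).1 w' (by rw [hw']; simp) hw'x
        have hw'T : Conn ends y a₂ w' := conn_trans hxT' (conn_of_openAdj ⟨e', hye', hw'⟩)
        rcases src_mark_mem_T ends a₁ a₂ b w F hs hw'T hw'm with hw'' | hw''
        · -- x has open edges to a₂ (e') and to o (e): x is flipped, both edges open in copy 2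
          subst w'
          have hsh := src_shares_of_two ends a₁ a₂ b w F hs hxm hye' hw' hye hends
          apply hno
          exact conn_trans
            (conn_of_openAdj ⟨e', open2_of_shares ends a₁ a₂ b w F hF hxm hsh hxe' hye',
              by rw [hw', Sym2.eq_swap]⟩)
            (conn_of_openAdj ⟨e, open2_of_shares ends a₁ a₂ b w F hF hxm hsh hxe hye, hends⟩)
        · exact hoe' (by rw [hw', hw'']; simp)
    refine ⟨hwo, ?_⟩
    -- (ii) w is not a red pendant at o: the open non-loop edge e at w avoids o
    rintro ⟨-, hall⟩
    rcases hall e hye hwe with h | h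
    · rw [hends] at h
      rcases Sym2.mem_iff.1 h with h | h
      · exact hxo h.symm
      · exact hwo h.symm
    · rw [hends] at h
      have : x ∈ s(w, w) := by rw [← h]; simp
      exact hxw (Sym2.mem_iff.1 this |>.elim id id)
  have hoZ : o ∈ Z₀ := mem_of_conn_of_closed hclosed ha₂ hs.ho
  exact hoZ.1 rfl

end Clusters

end TypedBHKIndep

end Summit.Ventures.PercRepro2
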